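import Summits.CriticalPhenomena.PercolationContinuityZ3.Theorems.PercNearOneGluingNoHeavyPcintKernZ6B4Defs
import HarnessLib

/-!
# PCINT lane, kernel check 3/4 of the B3r window certificate `d = 6`, memory 4 (3-step windows, 1728 codes): codes `864 ≤ c < 1296`

Cell `prim-pcint`, seat `prim-pcint-2` (gen 2).  Collatz–Wielandt rows `10^5 · row ≤ 99999 · DEN · v` for the window codes in
`[864, 1296)`, by `decide +kernel` in chunks of `108` codes (natural-number arithmetic only; `maxHeartbeats 0`).
Does NOT build on p205010.
-/

namespace Summit.CriticalPhenomena.PercolationContinuityZ3.Theorems.Pcint.Z6B4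

set_option maxHeartbeats 0 in
/-- Rows `864 ≤ c < 972` of the certificate hold. [folklore] -/
theorem chk_864_972 : chk 864 972 = true := by decide +kernel

set_option maxHeartbeats 0 in
/-- Rows `972 ≤ c < 1080` of the certificate hold. [folklore] -/
theorem chk_972_1080 : chk 972 1080 = true := by decide +kernel

set_option maxHeartbeats 0 in
/-- Rows `1080 ≤ c < 1188` of the certificate hold. [folklore] -/
theorem chk_1080_1188 : chk 1080 1188 = true := by decide +kernel

set_option maxHeartbeats 0 in
/-- Rows `1188 ≤ c < 1296` of the certificate hold. [folklore] -/
theorem chk_1188_1296 : chk 1188 1296 = true := by decide +kernel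

/-- Rows `864 ≤ c < 1296` of the certificate hold. [folklore] -/
theorem chkFile_3 : chk 864 1296 = true :=
  chk_split (chk_split (chk_split chk_864_972 chk_972_1080) chk_1080_1188) chk_1188_1296

end Summit.CriticalPhenomena.PercolationContinuityZ3.Theorems.Pcint.Z6B4
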